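import Mathlib
import Literature.Dynamics.NBody.AlbouyKaloshin2012Roberts

/-!
# Albouy–Kaloshin 2012, system (4): the angular-momentum syzygy

For ANY masses `m`, positions `q` and SYMMETRIC inverse-distance variables `δ` (no equation assumed),
the `2n` scalar residuals of system (4), `F_k := q_k − Σ_l m_l δ_kl³ (q_k − q_l) ∈ ℝ²`, satisfy the
linear relation `Σ_k m_k · (q_k ∧ F_k) = 0` (planar cross product). This is the algebraic shadow of
rotation invariance / conservation of angular momentum; it is the reason the `2n + n(n−1)/2` equations of
(4) in `2n − 1 + n(n−1)/2` unknowns (after the normalisation `y₂ := y₁` of Definition 2) are not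
over-determined, and why the Jacobian of (4) with respect to unknowns AND masses has rank at most
`2n + n(n−1)/2 − 1` at every solution with `(m_k q_k)_k ≠ 0`
(used in `run/shared/lean/pub/pub-smale6/certs/roberts_local/`: rank `19 = 20 − 1` at the Roberts points, `n = 5`).
[cite: AlbouyKaloshin2012, system (4) p. 540; the identity is the classical angular-momentum integral, cf. §2.2]
-/

namespace Literature.Dynamics.NBody

open Finset

/-- A double sum of an antisymmetric family vanishes. [folklore] -/
theorem sum_sum_eq_zero_of_antisymm {n : ℕ} (f : Fin n → Fin n → ℝ)
    (hf : ∀ k l, f k l + f l k = 0) : ∑ k, ∑ l, f k l = 0 := by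
  have h : ∑ k, ∑ l, f k l = ∑ k, ∑ l, f l k := Finset.sum_comm
  have h2 : ∑ k, ∑ l, f k l + ∑ k, ∑ l, f l k = 0 := by
    rw [← Finset.sum_add_distrib]
    apply Finset.sum_eq_zero
    intro k _
    rw [← Finset.sum_add_distrib]
    apply Finset.sum_eq_zero
    intro l _
    exact hf k l
  linarith

/-- The residual of the `k`-th vector equation of system (4): `F_k = q_k − Σ_l m_l δ_kl³ (q_k − q_l)`.
(`IsRealNormalizedCC m q δ` demands `F_k = 0` for all `k`, written as `q_k = Σ_l …`.)
[cite: AlbouyKaloshin2012, system (4) p. 540] -/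
def ak4Residual {n : ℕ} (m : Fin n → ℝ) (q : Fin n → ℝ × ℝ) (δ : Fin n → Fin n → ℝ) (k : Fin n) :
    ℝ × ℝ :=
  q k - ∑ l, (m l * δ k l ^ 3) • (q k - q l)

/-- **Angular-momentum syzygy of system (4).** For symmetric `δ` and arbitrary `m`, `q`:
`Σ_k m_k (x_k · (F_k)₂ − y_k · (F_k)₁) = 0`, where `F_k` is the residual `ak4Residual m q δ k`.
No equation of (4) is assumed. [cite: AlbouyKaloshin2012, system (4) p. 540] -/
theorem ak4Residual_angular_syzygy {n : ℕ} (m : Fin n → ℝ) (q : Fin n → ℝ × ℝ)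
    (δ : Fin n → Fin n → ℝ) (hδ : ∀ k l, δ k l = δ l k) :
    ∑ k, m k * ((q k).1 * (ak4Residual m q δ k).2 - (q k).2 * (ak4Residual m q δ k).1) = 0 := by
  have expand : ∀ k, m k * ((q k).1 * (ak4Residual m q δ k).2 - (q k).2 * (ak4Residual m q δ k).1)
      = ∑ l, m k * m l * δ k l ^ 3 * ((q k).1 * (q l).2 - (q k).2 * (q l).1) := by
    intro k
    simp only [ak4Residual, Prod.fst_sub, Prod.snd_sub, Prod.fst_sum, Prod.snd_sum, Prod.smul_fst,
      Prod.smul_snd, smul_eq_mul]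
    have e1 : m k * ((q k).1 * ((q k).2 - ∑ l, m l * δ k l ^ 3 * ((q k).2 - (q l).2)) -
        (q k).2 * ((q k).1 - ∑ l, m l * δ k l ^ 3 * ((q k).1 - (q l).1)))
        = m k * (q k).2 * (∑ l, m l * δ k l ^ 3 * ((q k).1 - (q l).1)) -
          m k * (q k).1 * (∑ l, m l * δ k l ^ 3 * ((q k).2 - (q l).2)) := by ring
    rw [e1, Finset.mul_sum, Finset.mul_sum, ← Finset.sum_sub_distrib]
    apply Finset.sum_congr rfl
    intro l _
    ring
  rw [Finset.sum_congr rfl (fun k _ => expand k)]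
  apply sum_sum_eq_zero_of_antisymm
  intro k l
  rw [hδ l k]
  ring

/-- Consequence at a solution: if `(q, δ)` is a real normalized central configuration for `m`
(`IsRealNormalizedCC`), each residual vanishes — recorded here only to tie the syzygy to Definition 2:
the syzygy is a relation among the EQUATIONS, valid off the solution set as well.
[cite: AlbouyKaloshin2012, Definition 2 p. 540] -/
theorem ak4Residual_eq_zero_of_isRealNormalizedCC {n : ℕ} {m : Fin n → ℝ} {q : Fin n → ℝ × ℝ}
    {δ : Fin n → Fin n → ℝ} (h : IsRealNormalizedCC m q δ) (k : Fin n) : ak4Residual m q δ k = 0 := by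
  obtain ⟨_, _, hcc, _⟩ := h
  unfold ak4Residual
  rw [← hcc k]
  simp

end Literature.Dynamics.NBody
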